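import Summits.HubbardSuperconductivity.HubbardSuperconductivity.Theorems.BcsKacWindowCoherenceWindowLROGroundStateTransfer

/-!
# Route `BcsKacWindow`, crux `CoherenceWindowLRO` — SHARP transfer to every sector ground state

Second helper file of the every-sector-ground-state step for the crux item
`stmt-HubbardSuperconductivity-1319` (`CoherenceWindowLRO`, rank 2 of route `BcsKacWindow`), line
`birth`; companion of `BcsKacWindowCoherenceWindowLROGroundStateTransfer` (leakage bound
`leakage_le`, parallelogram transfer, `coherenceWindowLRO_of_lowEnergySubspaces`).

The parallelogram transfer charges the leaked part of a ground state the full Yang ceiling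
`M ≍ L⁴` against an order of size `α ≍ Δ²L⁴`, and therefore needs the leakage — hence the
engine's off-diagonal precision — one power of `Δ` below the gap (`256L⁴ε² ≤ αγ²`, i.e.
`ε = O(Δ²/s)`). This file removes that loss. If the low-energy subspace `W` is also an APPROXIMATE
EIGENSPACE of the order observable, `‖B w‖ ≤ (α + β)‖w‖` on `W` (for the dressed `d`-wave BCS sector
vector `Δ_d†Δ_d w ≈ α w` up to a pair-fluctuation term of relative size `(N(0)/(α₀ΔL²))^{1/2} → 0` in
the window), then the cross term `2Re⟨r, B p⟩` is bounded by Cauchy–Schwarz and the leakage enters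
only linearly:

* `re_quadForm_add_ge_of_split` — for PSD `B`, unit `ψ = p + r` (`p ⊥ r`), `‖r‖² ≤ τ²`,
  `Re⟨p,Bp⟩ ≥ α‖p‖²`, `‖Bp‖ ≤ (α+β)‖p‖` ⟹ `Re⟨ψ,Bψ⟩ ≥ α(1 - τ²) - 2(α + β)τ`;
* `exists_mem_add_orth` — the orthogonal splitting `ψ = P_W ψ + r` (tree `projMatrix`);
* `re_quadForm_ge_of_lowEnergySubspace_sharp` — COUPLING form: (inside), (gap `γ`), (coupling `ε`)
  as in the companion file, `4ε²/γ² + 2θ/γ ≤ τ²` ⟹ the bound above for every unit `ψ ∈ K` of energy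
  `≤ E`;
* `re_quadForm_ge_of_gapForm` — GAP-FORM (Temple) version, no Hermiticity and no coupling constant:
  `Re⟨w+q, A(w+q)⟩ ≥ (E-η)(‖w‖²+‖q‖²) + γ‖q‖²` on orthogonal pairs `w ∈ W`, `q ∈ K ∩ W^⊥`, and
  `η ≤ γτ²` ⟹ the same bound;
* `coherenceWindowLRO_of_lowEnergySubspaces_sharp` — the crux BY NAME from window data
  `(W, γ, ε, α, β)` with `16ε ≤ γ`, `0 ≤ β ≤ α`, `α ≥ 4c₀Δ(U)²L⁴` (leakage `τ = 1/8`,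
  `α(1 - 1/64) - α/2 ≥ α/4`);
* `coherenceWindowLRO_of_gapForms` — the crux BY NAME from window data `(W, E₀, γ, η, α, β)`: a unit
  trial vector of the sector with energy `≤ E₀ + η`, the operator lower bound
  `H|_K ≥ E₀ + γ(1 - P_W)` written on orthogonal pairs, order `α ≥ 4c₀Δ(U)²L⁴` with `‖Bw‖ ≤ (α+β)‖w‖`,
  `β ≤ α`, and the resolution `64η ≤ γ`.

So the price of "EVERY sector ground state" in the window is exactly: locate the sector energy to
within a fixed fraction of the pair-momentum gap `γ ≍ Δ(U)/s` (from above by a trial state, from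
below by an operator inequality on the complement of `W`) — for each fixed `s` at small `U`, which is
why the crux lets `U₁` depend on `s`. Neither hypothesis is claimed; both are finite-volume,
source-free shapes of the output of a weak-coupling construction below
`Literature.Barriers.HubbardSuperconductivity.WeakCouplingCeiling` (item
`stmt-HubbardSuperconductivity-2010`).

Sources: G. Temple, Proc. R. Soc. A **119** (1928) 276 and T. Kato, J. Phys. Soc. Japan **4**
(1949) 334 (lower bounds / leakage from a gap); T. Kato, *Perturbation Theory for Linear Operators*
(1966) II-§1.4; H. Tasaki (2020) §2.2. Tree API: `leakage_le`, `re_quadForm_add`,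
`re_star_dotProduct_add_self_of_orth`, `minEnergyOn_mul_le_re_rayleigh`,
`minEnergyOn_le_rayleigh_of_mem`, `projMatrix_*`, `eucNorm`, `norm_star_dotProduct_le`.
Folklore finite-dimensional linear algebra; no definition and no named fact is introduced.
-/

set_option linter.dupNamespace false

namespace Summit.HubbardSuperconductivity.HubbardSuperconductivity.Theorems.BcsKacWindow

open Matrix Literature.MathematicalPhysics.QuantumLattice
open Literature.MathematicalPhysics.QuantumLattice.EigenvalueContinuation
open Summit.HubbardSuperconductivity.HubbardSuperconductivity.Theses.BcsKacWindow
open scoped ComplexOrder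

section LinearAlgebra

variable {ι : Type*} [Fintype ι]

/-- From `‖v‖² ≤ t²` (`t ≥ 0`) to `‖v‖ ≤ t` for the Euclidean norm of a coordinate vector. [folklore] -/
theorem eucNorm_le_of_sq_le {v : ι → ℂ} {t : ℝ} (ht : 0 ≤ t) (h : (star v ⬝ᵥ v).re ≤ t ^ 2) :
    eucNorm v ≤ t := by
  rw [← eucNorm_sq] at h
  by_contra hlt
  push Not at hlt
  have := pow_lt_pow_left₀ hlt ht two_ne_zero
  linarith

/-- **Sharp order transfer along an orthogonal splitting.** Let `B` be positive semidefinite and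
`ψ = p + r` a unit vector with `p† r = 0`. If the weight outside is small, `‖r‖² ≤ τ²`, the inside
carries order `Re⟨p, B p⟩ ≥ α‖p‖²` AND `p` is an approximate eigenvector of `B` in the weak sense
`‖B p‖ ≤ (α + β)‖p‖`, then `Re⟨ψ, B ψ⟩ ≥ α(1 - τ²) - 2(α + β)τ`: expand
`⟨ψ,Bψ⟩ = ⟨p,Bp⟩ + 2Re⟨r,Bp⟩ + ⟨r,Br⟩`, drop the last (nonnegative) term and bound the cross term by
Cauchy–Schwarz. Compared with the parallelogram route (`re_quadForm_ge_of_lowEnergySubspace`, which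
charges the leaked part the full ceiling `M‖r‖²`), the leakage enters only LINEARLY through
`‖Bp‖`, so a leakage `τ = O(1)` suffices whenever `β = O(α)`. [folklore] -/
theorem re_quadForm_add_ge_of_split {B : Matrix ι ι ℂ} (hB : B.PosSemidef) {p r : ι → ℂ}
    (hpr : star p ⬝ᵥ r = 0) (h1 : (star (p + r) ⬝ᵥ (p + r)).re = 1) {α β τ : ℝ} (hα : 0 ≤ α)
    (hαβ : 0 ≤ α + β) (hτ : 0 ≤ τ) (hR : (star r ⬝ᵥ r).re ≤ τ ^ 2)
    (hord : α * (star p ⬝ᵥ p).re ≤ (star p ⬝ᵥ B *ᵥ p).re)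
    (hBp : eucNorm (B *ᵥ p) ≤ (α + β) * eucNorm p) :
    α * (1 - τ ^ 2) - 2 * (α + β) * τ ≤ (star (p + r) ⬝ᵥ B *ᵥ (p + r)).re := by
  rw [re_quadForm_add hB.1 p r]
  rw [re_star_dotProduct_add_self_of_orth hpr] at h1
  -- the three terms
  have hBr : 0 ≤ (star r ⬝ᵥ B *ᵥ r).re := by
    have := hB.re_dotProduct_nonneg r
    simpa using this
  have hp0 : 0 ≤ (star p ⬝ᵥ p).re := by rw [← eucNorm_sq]; positivity
  have hr0 : 0 ≤ (star r ⬝ᵥ r).re := by rw [← eucNorm_sq]; positivity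
  have hnr : eucNorm r ≤ τ := eucNorm_le_of_sq_le hτ hR
  have hnp : eucNorm p ≤ 1 := eucNorm_le_of_sq_le zero_le_one (by rw [one_pow]; linarith)
  have hcross : -((α + β) * τ) ≤ (star r ⬝ᵥ B *ᵥ p).re := by
    have hcs : ‖star r ⬝ᵥ B *ᵥ p‖ ≤ eucNorm r * eucNorm (B *ᵥ p) := norm_star_dotProduct_le _ _
    have hre : -‖star r ⬝ᵥ B *ᵥ p‖ ≤ (star r ⬝ᵥ B *ᵥ p).re :=
      neg_le_of_abs_le (Complex.abs_re_le_norm _)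
    have hb1 : eucNorm r * eucNorm (B *ᵥ p) ≤ τ * ((α + β) * 1) := by
      have h2 : eucNorm (B *ᵥ p) ≤ (α + β) * 1 :=
        hBp.trans (mul_le_mul_of_nonneg_left hnp hαβ)
      exact mul_le_mul hnr h2 (eucNorm_nonneg _) hτ
    linarith
  have hordP : α * (1 - τ ^ 2) ≤ (star p ⬝ᵥ B *ᵥ p).re := by
    have : α * (1 - τ ^ 2) ≤ α * (star p ⬝ᵥ p).re :=
      mul_le_mul_of_nonneg_left (by linarith) hα
    linarith
  linarith

/-- **Orthogonal splitting along a subspace** (the tree's `projMatrix`): every `ψ` is `p + r` with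
`p ∈ W` and `r ⊥ W`. [folklore] -/
theorem exists_mem_add_orth [DecidableEq ι] (W : Submodule ℂ (ι → ℂ)) (ψ : ι → ℂ) :
    ∃ p ∈ W, ∃ r : ι → ℂ, ψ = p + r ∧ ∀ φ ∈ W, star φ ⬝ᵥ r = 0 := by
  classical
  set P : Matrix ι ι ℂ := projMatrix (W.map
    ((WithLp.linearEquiv 2 ℂ (ι → ℂ)).symm : (ι → ℂ) →ₗ[ℂ] EuclideanSpace ℂ ι)) with hP_def
  have hPh : P.IsHermitian := projMatrix_isHermitian _
  refine ⟨P *ᵥ ψ, projMatrix_map_mulVec_mem W ψ, ψ - P *ᵥ ψ, (add_sub_cancel _ _).symm, ?_⟩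
  intro φ hφ
  have hfix : P *ᵥ φ = φ := projMatrix_map_mulVec_of_mem W hφ
  have hPφ : star φ ⬝ᵥ (P *ᵥ ψ) = star φ ⬝ᵥ ψ := by
    conv_rhs => rw [← hfix]
    rw [star_mulVec, hPh.eq, ← dotProduct_mulVec]
  rw [dotProduct_sub, hPφ, sub_self]

/-- **Sharp order transfer to every low-energy vector of a sector (coupling form).** Hypotheses
(inside), (gap), (coupling) as in `re_quadForm_ge_of_lowEnergySubspace`, order `α` on `W`, and the
approximate-eigenvector bound `‖B w‖ ≤ (α + β)‖w‖` on `W` in place of a ceiling on `W^⊥`; if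
`4ε²/γ² + 2θ/γ ≤ τ²` then every unit `ψ ∈ K` of energy `≤ E` has
`Re⟨ψ, B ψ⟩ ≥ α(1 - τ²) - 2(α + β)τ`. (Leakage `‖r‖² ≤ τ²‖P_W ψ‖² ≤ τ²` by `leakage_le`, then
`re_quadForm_add_ge_of_split`.) Kato (1966) II-§1.4; folklore in this form. [folklore] -/
theorem re_quadForm_ge_of_lowEnergySubspace_sharp [DecidableEq ι] {A B : Matrix ι ι ℂ}
    (hA : A.IsHermitian) (hB : B.PosSemidef) {K W : Submodule ℂ (ι → ℂ)} (hWK : W ≤ K)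
    {E γ ε θ α β τ : ℝ} (hγ : 0 < γ) (hα : 0 ≤ α) (hαβ : 0 ≤ α + β) (hτ : 0 ≤ τ)
    (hκτ : 4 * ε ^ 2 / γ ^ 2 + 2 * θ / γ ≤ τ ^ 2)
    (hw : ∀ w ∈ W, (E - θ) * (star w ⬝ᵥ w).re ≤ (star w ⬝ᵥ A *ᵥ w).re)
    (hq : ∀ q ∈ K, (∀ w ∈ W, star w ⬝ᵥ q = 0) →
      (E + γ) * (star q ⬝ᵥ q).re ≤ (star q ⬝ᵥ A *ᵥ q).re)
    (hoff : ∀ q ∈ K, (∀ w ∈ W, star w ⬝ᵥ q = 0) → ∀ w ∈ W,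
      ‖star q ⬝ᵥ A *ᵥ w‖ ≤ ε * (eucNorm q * eucNorm w))
    (hord : ∀ w ∈ W, α * (star w ⬝ᵥ w).re ≤ (star w ⬝ᵥ B *ᵥ w).re)
    (hBw : ∀ w ∈ W, eucNorm (B *ᵥ w) ≤ (α + β) * eucNorm w)
    {ψ : ι → ℂ} (hψK : ψ ∈ K) (hψ1 : star ψ ⬝ᵥ ψ = 1) (hlow : (star ψ ⬝ᵥ A *ᵥ ψ).re ≤ E) :
    α * (1 - τ ^ 2) - 2 * (α + β) * τ ≤ (star ψ ⬝ᵥ B *ᵥ ψ).re := by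
  obtain ⟨p, hpW, r, hψeq, hrorth⟩ := exists_mem_add_orth W ψ
  have hpK : p ∈ K := hWK hpW
  have hrK : r ∈ K := by
    have : r = ψ - p := by rw [hψeq, add_sub_cancel_left]
    rw [this]
    exact K.sub_mem hψK hpK
  have hpr : star p ⬝ᵥ r = 0 := hrorth p hpW
  -- leakage
  have hlow' : (star (p + r) ⬝ᵥ A *ᵥ (p + r)).re ≤ E * (star (p + r) ⬝ᵥ (p + r)).re := by
    rw [← hψeq, hψ1, Complex.one_re, mul_one]
    exact hlow
  have hleak := leakage_le hA hpr hγ hlow' (hw p hpW) (hq r hrK hrorth) (hoff r hrK hrorth p hpW)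
  have h1 : (star (p + r) ⬝ᵥ (p + r)).re = 1 := by rw [← hψeq, hψ1, Complex.one_re]
  have hsum : (star p ⬝ᵥ p).re + (star r ⬝ᵥ r).re = 1 := by
    rw [← re_star_dotProduct_add_self_of_orth hpr, h1]
  have hr0 : 0 ≤ (star r ⬝ᵥ r).re := by rw [← eucNorm_sq]; positivity
  have hR : (star r ⬝ᵥ r).re ≤ τ ^ 2 := by
    -- `R ≤ (4ε²/γ² + 2θ/γ) P ≤ τ² P ≤ τ²`
    have hκ : (4 * ε ^ 2 / γ ^ 2 + 2 * θ / γ) * (star p ⬝ᵥ p).re =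
        (2 / γ) * ((2 * ε ^ 2 / γ + θ) * (star p ⬝ᵥ p).re) := by
      field_simp
      ring
    have h2γ : (0 : ℝ) ≤ 2 / γ := by positivity
    have hRle : (star r ⬝ᵥ r).re ≤ (4 * ε ^ 2 / γ ^ 2 + 2 * θ / γ) * (star p ⬝ᵥ p).re := by
      calc (star r ⬝ᵥ r).re = (2 / γ) * (γ / 2 * (star r ⬝ᵥ r).re) := by field_simp
        _ ≤ (2 / γ) * ((2 * ε ^ 2 / γ + θ) * (star p ⬝ᵥ p).re) :=
            mul_le_mul_of_nonneg_left hleak h2γ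
        _ = _ := hκ.symm
    have hP1 : (star p ⬝ᵥ p).re ≤ 1 := by linarith
    have hp0 : 0 ≤ (star p ⬝ᵥ p).re := by rw [← eucNorm_sq]; positivity
    calc (star r ⬝ᵥ r).re ≤ (4 * ε ^ 2 / γ ^ 2 + 2 * θ / γ) * (star p ⬝ᵥ p).re := hRle
      _ ≤ τ ^ 2 * (star p ⬝ᵥ p).re := mul_le_mul_of_nonneg_right hκτ hp0
      _ ≤ τ ^ 2 * 1 := mul_le_mul_of_nonneg_left hP1 (sq_nonneg τ)
      _ = τ ^ 2 := mul_one _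
  rw [hψeq]
  exact re_quadForm_add_ge_of_split hB hpr h1 hα hαβ hτ hR (hord p hpW) (hBw p hpW)

/-- **Sharp order transfer, quadratic-form (Temple) version — no Hermiticity, no coupling constant.**
Suppose the energy form of `A` on the sector `K` dominates a GAP FORM along `W`:
`Re⟨w + q, A(w + q)⟩ ≥ (E - η)(‖w‖² + ‖q‖²) + γ‖q‖²` for `w ∈ W`, `q ∈ K ∩ W^⊥` (`γ > 0`), and
`η ≤ γτ²`. Then every unit `ψ ∈ K` of energy `≤ E` leaks at most `‖(1 - P_W)ψ‖² ≤ η/γ ≤ τ²`, and with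
order `α` on `W` and `‖B w‖ ≤ (α + β)‖w‖` on `W` one gets `Re⟨ψ, Bψ⟩ ≥ α(1 - τ²) - 2(α + β)τ`.
(This is the shape in which a variational construction — an energy lower bound on the sector as an
operator inequality plus a trial state — delivers its output; cf. the tree's
`exists_gap_groundProj_form`.) Temple (1928) / Kato (1949) type; folklore in this form. [folklore] -/
theorem re_quadForm_ge_of_gapForm [DecidableEq ι] {A B : Matrix ι ι ℂ} (hB : B.PosSemidef)
    {K W : Submodule ℂ (ι → ℂ)} (hWK : W ≤ K) {E γ η α β τ : ℝ} (hγ : 0 < γ) (hα : 0 ≤ α)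
    (hαβ : 0 ≤ α + β) (hτ : 0 ≤ τ) (hητ : η ≤ γ * τ ^ 2)
    (hform : ∀ w ∈ W, ∀ q ∈ K, (∀ w' ∈ W, star w' ⬝ᵥ q = 0) →
      (E - η) * ((star w ⬝ᵥ w).re + (star q ⬝ᵥ q).re) + γ * (star q ⬝ᵥ q).re ≤
        (star (w + q) ⬝ᵥ A *ᵥ (w + q)).re)
    (hord : ∀ w ∈ W, α * (star w ⬝ᵥ w).re ≤ (star w ⬝ᵥ B *ᵥ w).re)
    (hBw : ∀ w ∈ W, eucNorm (B *ᵥ w) ≤ (α + β) * eucNorm w)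
    {ψ : ι → ℂ} (hψK : ψ ∈ K) (hψ1 : star ψ ⬝ᵥ ψ = 1) (hlow : (star ψ ⬝ᵥ A *ᵥ ψ).re ≤ E) :
    α * (1 - τ ^ 2) - 2 * (α + β) * τ ≤ (star ψ ⬝ᵥ B *ᵥ ψ).re := by
  obtain ⟨p, hpW, r, hψeq, hrorth⟩ := exists_mem_add_orth W ψ
  have hpK : p ∈ K := hWK hpW
  have hrK : r ∈ K := by
    have : r = ψ - p := by rw [hψeq, add_sub_cancel_left]
    rw [this]
    exact K.sub_mem hψK hpK
  have hpr : star p ⬝ᵥ r = 0 := hrorth p hpW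
  have h1 : (star (p + r) ⬝ᵥ (p + r)).re = 1 := by rw [← hψeq, hψ1, Complex.one_re]
  have hsum : (star p ⬝ᵥ p).re + (star r ⬝ᵥ r).re = 1 := by
    rw [← re_star_dotProduct_add_self_of_orth hpr, h1]
  have hf := hform p hpW r hrK hrorth
  rw [← hψeq, hsum] at hf
  -- `(E - η) + γ R ≤ Re⟨ψ,Aψ⟩ ≤ E`, so `γ R ≤ η ≤ γ τ²`
  have hR : (star r ⬝ᵥ r).re ≤ τ ^ 2 := by
    have hγR : γ * (star r ⬝ᵥ r).re ≤ γ * τ ^ 2 := by linarith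
    exact le_of_mul_le_mul_left hγR hγ
  rw [hψeq]
  exact re_quadForm_add_ge_of_split hB hpr h1 hα hαβ hτ hR (hord p hpW) (hBw p hpW)

end LinearAlgebra

/-! ### The crux from SHARP low-energy-subspace data on the window tori -/

/-- **`CoherenceWindowLRO` from low-energy-subspace data, sharp (coupling) form.** As
`coherenceWindowLRO_of_lowEnergySubspaces`, but with the approximate-eigenvector bound
`‖Δ_d†Δ_d w‖ ≤ (α + β)‖w‖` (`0 ≤ β ≤ α`) on `W` replacing Yang's ceiling on `W^⊥`: then the
coupling need only be a fixed fraction of the gap, `16ε ≤ γ` (leakage `τ = 1/8`), instead of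
`O(γ·Δ)`; every unit sector ground state gets `Re⟨ψ, Δ_d†Δ_d ψ⟩ ≥ α(1 - 1/64) - 4α/8 ≥ α/4 ≥ c₀Δ(U)²L⁴`.
(For the intended `W` — the dressed number-projected `d`-wave BCS sector vector and its nodal band —
`Δ_d†Δ_d w ≈ α w` up to a pair-fluctuation term of relative size `(N(0)/(α₀ Δ L²))^{1/2} → 0` in the
window, so `β ≤ α` is the natural regime.) The hypothesis is NOT claimed here. [folklore] -/
theorem coherenceWindowLRO_of_lowEnergySubspaces_sharp :
    (∃ (a b κ₁ κ₂ c₀ s₀ : ℝ) (Δ : ℝ → ℝ), 0 < a ∧ a < b ∧ b < 1 / 2 ∧ 0 < κ₁ ∧ κ₁ ≤ κ₂ ∧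
      0 < c₀ ∧ 0 < s₀ ∧
      (∀ U : ℝ, 0 < U → Real.exp (-(κ₂ / U ^ 2)) ≤ Δ U ∧ Δ U ≤ Real.exp (-(κ₁ / U ^ 2))) ∧
      ∀ s : ℝ, s₀ ≤ s → ∃ U₁ : ℝ, 0 < U₁ ∧ ∀ δ ∈ Set.Icc a b, ∀ U ∈ Set.Ioo (0 : ℝ) U₁,
        ∀ (L : ℕ) [NeZero L], Even L → s₀ ≤ Δ U * L → Δ U * L ≤ s →
          ∃ (W : Submodule ℂ (Fock (Orb (FermionTorus 2 L)))) (γ ε α β : ℝ),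
            W ≤ szSector (2 * ⌊(1 - δ) * (L : ℝ) ^ 2 / 2⌋₊) 0 ∧ 0 < γ ∧ 0 ≤ ε ∧ 16 * ε ≤ γ ∧
            0 ≤ β ∧ β ≤ α ∧ 4 * c₀ * Δ U ^ 2 * (L : ℝ) ^ 4 ≤ α ∧
            (∀ q ∈ szSector (2 * ⌊(1 - δ) * (L : ℝ) ^ 2 / 2⌋₊) 0, (∀ w ∈ W, star w ⬝ᵥ q = 0) →
              ((hubbardTorus 2 L 1 U).minEnergyOn (szSector (2 * ⌊(1 - δ) * (L : ℝ) ^ 2 / 2⌋₊) 0)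
                  + γ) * (star q ⬝ᵥ q).re ≤ (star q ⬝ᵥ hubbardTorus 2 L 1 U *ᵥ q).re) ∧
            (∀ q ∈ szSector (2 * ⌊(1 - δ) * (L : ℝ) ^ 2 / 2⌋₊) 0, (∀ w ∈ W, star w ⬝ᵥ q = 0) →
              ∀ w ∈ W, ‖star q ⬝ᵥ hubbardTorus 2 L 1 U *ᵥ w‖ ≤ ε * (eucNorm q * eucNorm w)) ∧
            (∀ w ∈ W, α * (star w ⬝ᵥ w).re ≤
              (star w ⬝ᵥ ((pairField dWaveFormFactor L)ᴴ * pairField dWaveFormFactor L) *ᵥ w).re) ∧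
            (∀ w ∈ W, eucNorm (((pairField dWaveFormFactor L)ᴴ * pairField dWaveFormFactor L) *ᵥ w)
              ≤ (α + β) * eucNorm w)) →
    CoherenceWindowLRO := by
  intro h
  obtain ⟨a, b, κ₁, κ₂, c₀, s₀, Δ, ha, hab, hb, hκ₁, hκ₁₂, hc₀, hs₀, hpin, hS⟩ := h
  refine ⟨a, b, κ₁, κ₂, c₀, s₀, Δ, ha, hab, hb, hκ₁, hκ₁₂, hc₀, hs₀, hpin, fun s hs => ?_⟩
  obtain ⟨U₁, hU₁, hwin⟩ := hS s hs
  clear hS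
  refine ⟨U₁, hU₁, ?_⟩
  intro δ hδ U hU L _ hE hlo hhi ψ hψ1 hgs
  obtain ⟨W, γ, ε, α, β, hWK, hγ, hε, hεγ, hβ, hβα, hαc, hgap, hoff, hord, hBw⟩ :=
    hwin δ hδ U hU L hE hlo hhi
  clear hwin
  have hHh : (hubbardTorus 2 L 1 U).IsHermitian :=
    hubbardTorus_isHermitian (hamiltonian_isHermitian_and_commute_holds _) 1 U
  have hBp : ((pairField dWaveFormFactor L)ᴴ * pairField dWaveFormFactor L).PosSemidef :=
    pairField_conjTranspose_mul_self_posSemidef dWaveFormFactor L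
  obtain ⟨hψK, -, hHψ⟩ := hgs
  have hΔpos : 0 < Δ U := lt_of_lt_of_le (Real.exp_pos _) (hpin U hU.1).1
  have hLpos : (0 : ℝ) < (L : ℝ) := Nat.cast_pos.mpr (Nat.pos_of_ne_zero (NeZero.ne L))
  have hα0 : 0 ≤ α := le_trans (by positivity) hαc
  -- (inside) with `θ = 0` by the variational principle; energy of the ground state `= e`
  have hw : ∀ w ∈ W, ((hubbardTorus 2 L 1 U).minEnergyOn
      (szSector (2 * ⌊(1 - δ) * (L : ℝ) ^ 2 / 2⌋₊) 0) - 0) * (star w ⬝ᵥ w).re ≤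
        (star w ⬝ᵥ hubbardTorus 2 L 1 U *ᵥ w).re := by
    intro w hw
    rw [sub_zero]
    exact minEnergyOn_mul_le_re_rayleigh hHh _ (hWK hw)
  have hlow : (star ψ ⬝ᵥ hubbardTorus 2 L 1 U *ᵥ ψ).re ≤
      (hubbardTorus 2 L 1 U).minEnergyOn (szSector (2 * ⌊(1 - δ) * (L : ℝ) ^ 2 / 2⌋₊) 0) := by
    rw [hHψ, dotProduct_smul, hψ1, smul_eq_mul, mul_one, Complex.ofReal_re]
  -- leakage parameter `τ = 1/8`: `4ε²/γ² ≤ 1/64` from `16 ε ≤ γ`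
  have hκτ : 4 * ε ^ 2 / γ ^ 2 + 2 * 0 / γ ≤ (1 / 8 : ℝ) ^ 2 := by
    rw [mul_zero, zero_div, add_zero, div_le_iff₀ (by positivity)]
    nlinarith [mul_le_mul hεγ hεγ (by positivity) (by positivity)]
  have hαβ : 0 ≤ α + β := by linarith
  have hmain := re_quadForm_ge_of_lowEnergySubspace_sharp hHh hBp hWK hγ hα0 hαβ
    (by norm_num : (0 : ℝ) ≤ 1 / 8) hκτ hw hgap hoff hord hBw hψK hψ1 hlow
  -- `α (1 - 1/64) - 2 (α + β)/8 ≥ α/4 ≥ c₀ Δ² L⁴`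
  have hL4 : (0 : ℝ) < (L : ℝ) ^ 4 := by positivity
  rw [le_div_iff₀ hL4]
  simp only [expect]
  nlinarith [hmain, hβα, hαc]

/-- **`CoherenceWindowLRO` from GAP FORMS on the window tori (Temple form of the engine output).**
With the crux's constants and pins, suppose every window torus carries, for `H = hubbardTorus 2 L 1 U`,
`K = szSector N 0` and `B = Δ_d†Δ_d`: a subspace `W ≤ K` and reals `E₀`, `γ > 0`, `η ≥ 0`,
`0 ≤ β ≤ α` with
* (trial state) a unit `φ ∈ K` with `Re⟨φ, H φ⟩ ≤ E₀ + η` — so the sector energy is `≤ E₀ + η`;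
* (gap form) `Re⟨w + q, H(w + q)⟩ ≥ E₀(‖w‖² + ‖q‖²) + γ‖q‖²` for `w ∈ W`, `q ∈ K ∩ W^⊥` — an
  operator lower bound `H|_K ≥ E₀ + γ(1 - P_W)`;
* (order) `Re⟨w, Δ_d†Δ_d w⟩ ≥ α‖w‖²` on `W` with `α ≥ 4c₀Δ(U)²L⁴`, and `‖Δ_d†Δ_d w‖ ≤ (α + β)‖w‖`;
* (resolution) `64η ≤ γ`.
Then `CoherenceWindowLRO`: a unit sector ground state has energy `e ≤ E₀ + η`, the gap form with
`E := E₀ + η` leaks at most `η/γ ≤ 1/64`, and `re_quadForm_ge_of_gapForm` (`τ = 1/8`) gives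
`Re⟨ψ, Δ_d†Δ_d ψ⟩ ≥ α/4 ≥ c₀Δ(U)²L⁴`. No coupling constant and no ceiling are needed; the
resolution `η = O(γ) = O(Δ(U)/s)` on the sector energy is the whole price of "every ground state".
The hypothesis is NOT claimed here. [folklore] -/
theorem coherenceWindowLRO_of_gapForms :
    (∃ (a b κ₁ κ₂ c₀ s₀ : ℝ) (Δ : ℝ → ℝ), 0 < a ∧ a < b ∧ b < 1 / 2 ∧ 0 < κ₁ ∧ κ₁ ≤ κ₂ ∧
      0 < c₀ ∧ 0 < s₀ ∧
      (∀ U : ℝ, 0 < U → Real.exp (-(κ₂ / U ^ 2)) ≤ Δ U ∧ Δ U ≤ Real.exp (-(κ₁ / U ^ 2))) ∧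
      ∀ s : ℝ, s₀ ≤ s → ∃ U₁ : ℝ, 0 < U₁ ∧ ∀ δ ∈ Set.Icc a b, ∀ U ∈ Set.Ioo (0 : ℝ) U₁,
        ∀ (L : ℕ) [NeZero L], Even L → s₀ ≤ Δ U * L → Δ U * L ≤ s →
          ∃ (W : Submodule ℂ (Fock (Orb (FermionTorus 2 L)))) (E₀ γ η α β : ℝ),
            W ≤ szSector (2 * ⌊(1 - δ) * (L : ℝ) ^ 2 / 2⌋₊) 0 ∧ 0 < γ ∧ 0 ≤ η ∧ 64 * η ≤ γ ∧
            0 ≤ β ∧ β ≤ α ∧ 4 * c₀ * Δ U ^ 2 * (L : ℝ) ^ 4 ≤ α ∧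
            (∃ φ ∈ szSector (2 * ⌊(1 - δ) * (L : ℝ) ^ 2 / 2⌋₊) 0, star φ ⬝ᵥ φ = 1 ∧
              (star φ ⬝ᵥ hubbardTorus 2 L 1 U *ᵥ φ).re ≤ E₀ + η) ∧
            (∀ w ∈ W, ∀ q ∈ szSector (2 * ⌊(1 - δ) * (L : ℝ) ^ 2 / 2⌋₊) 0,
              (∀ w' ∈ W, star w' ⬝ᵥ q = 0) →
                E₀ * ((star w ⬝ᵥ w).re + (star q ⬝ᵥ q).re) + γ * (star q ⬝ᵥ q).re ≤
                  (star (w + q) ⬝ᵥ hubbardTorus 2 L 1 U *ᵥ (w + q)).re) ∧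
            (∀ w ∈ W, α * (star w ⬝ᵥ w).re ≤
              (star w ⬝ᵥ ((pairField dWaveFormFactor L)ᴴ * pairField dWaveFormFactor L) *ᵥ w).re) ∧
            (∀ w ∈ W, eucNorm (((pairField dWaveFormFactor L)ᴴ * pairField dWaveFormFactor L) *ᵥ w)
              ≤ (α + β) * eucNorm w)) →
    CoherenceWindowLRO := by
  intro h
  obtain ⟨a, b, κ₁, κ₂, c₀, s₀, Δ, ha, hab, hb, hκ₁, hκ₁₂, hc₀, hs₀, hpin, hS⟩ := h
  refine ⟨a, b, κ₁, κ₂, c₀, s₀, Δ, ha, hab, hb, hκ₁, hκ₁₂, hc₀, hs₀, hpin, fun s hs => ?_⟩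
  obtain ⟨U₁, hU₁, hwin⟩ := hS s hs
  clear hS
  refine ⟨U₁, hU₁, ?_⟩
  intro δ hδ U hU L _ hE hlo hhi ψ hψ1 hgs
  obtain ⟨W, E₀, γ, η, α, β, hWK, hγ, hη, hηγ, hβ, hβα, hαc, ⟨φ, hφK, hφ1, hφE⟩, hform, hord,
    hBw⟩ := hwin δ hδ U hU L hE hlo hhi
  clear hwin
  have hHh : (hubbardTorus 2 L 1 U).IsHermitian :=
    hubbardTorus_isHermitian (hamiltonian_isHermitian_and_commute_holds _) 1 U
  have hBp : ((pairField dWaveFormFactor L)ᴴ * pairField dWaveFormFactor L).PosSemidef :=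
    pairField_conjTranspose_mul_self_posSemidef dWaveFormFactor L
  obtain ⟨hψK, -, hHψ⟩ := hgs
  have hΔpos : 0 < Δ U := lt_of_lt_of_le (Real.exp_pos _) (hpin U hU.1).1
  have hLpos : (0 : ℝ) < (L : ℝ) := Nat.cast_pos.mpr (Nat.pos_of_ne_zero (NeZero.ne L))
  have hα0 : 0 ≤ α := le_trans (by positivity) hαc
  have hαβ : 0 ≤ α + β := by linarith
  -- the ground-state energy is the sector energy, which the trial state bounds by `E₀ + η`
  have hlow : (star ψ ⬝ᵥ hubbardTorus 2 L 1 U *ᵥ ψ).re ≤ E₀ + η := by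
    have he : (star ψ ⬝ᵥ hubbardTorus 2 L 1 U *ᵥ ψ).re =
        (hubbardTorus 2 L 1 U).minEnergyOn (szSector (2 * ⌊(1 - δ) * (L : ℝ) ^ 2 / 2⌋₊) 0) := by
      rw [hHψ, dotProduct_smul, hψ1, smul_eq_mul, mul_one, Complex.ofReal_re]
    rw [he]
    exact (minEnergyOn_le_rayleigh_of_mem hHh _ hφK hφ1).trans hφE
  -- the gap form with `E := E₀ + η`
  have hform' : ∀ w ∈ W, ∀ q ∈ szSector (2 * ⌊(1 - δ) * (L : ℝ) ^ 2 / 2⌋₊) 0,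
      (∀ w' ∈ W, star w' ⬝ᵥ q = 0) →
        (E₀ + η - η) * ((star w ⬝ᵥ w).re + (star q ⬝ᵥ q).re) + γ * (star q ⬝ᵥ q).re ≤
          (star (w + q) ⬝ᵥ hubbardTorus 2 L 1 U *ᵥ (w + q)).re := by
    intro w hw q hq hqorth
    rw [add_sub_cancel_right]
    exact hform w hw q hq hqorth
  have hητ : η ≤ γ * (1 / 8 : ℝ) ^ 2 := by nlinarith
  have hmain := re_quadForm_ge_of_gapForm hBp hWK hγ hα0 hαβ (by norm_num : (0 : ℝ) ≤ 1 / 8) hητ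
    hform' hord hBw hψK hψ1 hlow
  have hL4 : (0 : ℝ) < (L : ℝ) ^ 4 := by positivity
  rw [le_div_iff₀ hL4]
  simp only [expect]
  nlinarith [hmain, hβα, hαc]

end Summit.HubbardSuperconductivity.HubbardSuperconductivity.Theorems.BcsKacWindow
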